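import Mathlib
import HarnessLib
import Summits.HubbardSuperconductivity.HubbardSuperconductivity.Theorems.KLProgrammeKLRegimeEnginePairTransferBudgetDressingProfile
import Summits.HubbardSuperconductivity.HubbardSuperconductivity.Theorems.KLProgrammeKLRegimeEnginePairTransferBudgetDressingLinear

/-!
# Route `KLProgramme` — ENGINE child gen 8 (stmt-HubbardSuperconductivity-20437 `KLRegimeEngineV17F2`), skeleton v2 class #5 rev 3, (X).3 BUDGET ARITHMETIC (block B3b):
# the THREE-TERM MAJORANT through the dressing — `klbd_threeTerm_dressing_rungProfile`
# (cell gate-hubbard-kl, seat hubbard-kl-k3c1-p1 g15; row 80 of CLASS5-RESOLVED-STEP.md / KLTC-INDEX v12; over rows 77/78/79)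

WHY.  The explicit part of candidate «76»'s `Ran` lower bound is, pointwise in `(x,y)`, below a three-term majorant
`C₀ + c_d·min(|x−y|_𝕋/Λₙ₊₁, Λₙ₊₁/|x−y|_𝕋) + c_x·min(|x+y−Qm′|_𝕋/Λₙ₊₁, Λₙ₊₁/|x+y−Qm′|_𝕋)` with `C₀, c_d, c_x ≥ 0` depending on `n, j′` only (block B3a).  This file prices the
majorant's dressed total by the rung profiles `ρ_j, ρ_{j′}` of the two dressings (`klbd_dressing_add` + `klbd_const_dressing` + `klbd_minProfile_dressing_rungProfile(_crossed)`):
`𝒟[C₀ + c_d·min_d + c_x·min_x](k,k′) ≤ C₀·(1 + (3m/2)·738288)² + c_d·min_d(k,k′) + c_x·min_x(k,k′) + (c_d + c_x)·((3m/2)·2W + (3m/2)²·738288·W)`,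
`W = (n+3)·((2·369144/π)·Λₙ₊₁·(1+2I) + 738288/2^I)` (any `I`) — i.e. the majorant costs its two `min` VALUES (the ROOM's `min` slots) plus constants in the `2⁻ⁿ`-slot currency.
With block B3a (pointwise majorant) and `klbd_dressing_mono` this is the whole explicit side of the budget row; the comparison with `θ·(3/5)·ROOM` is then ONE numeric row (B4).
Pure real arithmetic over rows 77–79; nothing about the model's sizes is asserted; nothing asserts (X).3, (c), K3 or superconductivity.  0 kit · 0 lit.
-/

noncomputable section

namespace Summit.HubbardSuperconductivity.HubbardSuperconductivity.Theorems.KLRegimeSplit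

set_option linter.dupNamespace false -- summit = problem name (single-conjunct summit), D-0017

open Finset Literature.MathematicalPhysics.QuantumLattice Literature.Probability.LatticeModels
open Summit.HubbardSuperconductivity.HubbardSuperconductivity.Theorems.KLProgrammeLegKernels
open Summit.HubbardSuperconductivity.HubbardSuperconductivity.Theorems.DispersionFlow

section ThreeTerm

variable {L M : ℕ} [NeZero L] (β μ : ℝ) (K : TrigPolyC4v) {R : RenConsts} {U : ℝ} {N : ℕ}

/-- **The three-term majorant through the dressing** (`ρ = ρ_j`, `ρ′ = ρ_{j′}` the rung profiles `klRungProfile … n s_{n+1,·} Qm`; `C₀, c_d, c_x, m ≥ 0`; any shell number `I`;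
`W := (n+3)·((2·369144/π)·Λₙ₊₁·(1+2I) + 738288/2^I)`). -/
theorem klbd_threeTerm_dressing_rungProfile (hK : FrameOK R U N μ K) (hβ : klBetaMin ≤ β) (hβL : β ≤ L) {n j j' : ℕ} (hj' : n + 1 ≤ j') (hjj : j' ≤ j)
    (hη₀ : Real.pi / (L : ℝ) ≤ klScale klE0 (n + 1)) (I : ℕ) (Qm Qm' : TorusSite 2 L) {C₀ cd cx m : ℝ} (h0 : 0 ≤ C₀) (hd : 0 ≤ cd) (hx : 0 ≤ cx) (hm : 0 ≤ m)
    (k k' : TorusSite 2 L) :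
    (C₀ + cd * min (klTorusNorm L (k - k') / klScale klE0 (n + 1)) (klScale klE0 (n + 1) / klTorusNorm L (k - k')) +
        cx * min (klTorusNorm L (k + k' - Qm') / klScale klE0 (n + 1)) (klScale klE0 (n + 1) / klTorusNorm L (k + k' - Qm'))) +
      ∑ c', (C₀ + cd * min (klTorusNorm L (k - c') / klScale klE0 (n + 1)) (klScale klE0 (n + 1) / klTorusNorm L (k - c')) +
          cx * min (klTorusNorm L (k + c' - Qm') / klScale klE0 (n + 1)) (klScale klE0 (n + 1) / klTorusNorm L (k + c' - Qm'))) *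
        klRungProfile L M β μ K n (softSymbolCompl L M β μ K (n + 1) j') Qm c' * (3 / 2 * m) +
      ∑ a, 3 / 2 * m * klRungProfile L M β μ K n (softSymbolCompl L M β μ K (n + 1) j) Qm a *
        (C₀ + cd * min (klTorusNorm L (a - k') / klScale klE0 (n + 1)) (klScale klE0 (n + 1) / klTorusNorm L (a - k')) +
          cx * min (klTorusNorm L (a + k' - Qm') / klScale klE0 (n + 1)) (klScale klE0 (n + 1) / klTorusNorm L (a + k' - Qm'))) +
      ∑ a, ∑ c', 3 / 2 * m * klRungProfile L M β μ K n (softSymbolCompl L M β μ K (n + 1) j) Qm a *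
        (C₀ + cd * min (klTorusNorm L (a - c') / klScale klE0 (n + 1)) (klScale klE0 (n + 1) / klTorusNorm L (a - c')) +
          cx * min (klTorusNorm L (a + c' - Qm') / klScale klE0 (n + 1)) (klScale klE0 (n + 1) / klTorusNorm L (a + c' - Qm'))) *
        klRungProfile L M β μ K n (softSymbolCompl L M β μ K (n + 1) j') Qm c' * (3 / 2 * m) ≤
      C₀ * (1 + 3 / 2 * m * 738288) * (1 + 3 / 2 * m * 738288) +
        (cd * min (klTorusNorm L (k - k') / klScale klE0 (n + 1)) (klScale klE0 (n + 1) / klTorusNorm L (k - k')) +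
          cd * (3 / 2 * m) * (((n + 1 : ℕ) + 2) * (2 * 369144 / Real.pi * klScale klE0 (n + 1) * (1 + 2 * I) + 738288 / 2 ^ I) +
            ((n + 1 : ℕ) + 2) * (2 * 369144 / Real.pi * klScale klE0 (n + 1) * (1 + 2 * I) + 738288 / 2 ^ I)) +
          cd * (3 / 2 * m) * (3 / 2 * m) * (738288 * (((n + 1 : ℕ) + 2) * (2 * 369144 / Real.pi * klScale klE0 (n + 1) * (1 + 2 * I) + 738288 / 2 ^ I)))) +
        (cx * min (klTorusNorm L (k + k' - Qm') / klScale klE0 (n + 1)) (klScale klE0 (n + 1) / klTorusNorm L (k + k' - Qm')) +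
          cx * (3 / 2 * m) * (((n + 1 : ℕ) + 2) * (2 * 369144 / Real.pi * klScale klE0 (n + 1) * (1 + 2 * I) + 738288 / 2 ^ I) +
            ((n + 1 : ℕ) + 2) * (2 * 369144 / Real.pi * klScale klE0 (n + 1) * (1 + 2 * I) + 738288 / 2 ^ I)) +
          cx * (3 / 2 * m) * (3 / 2 * m) * (738288 * (((n + 1 : ℕ) + 2) * (2 * 369144 / Real.pi * klScale klE0 (n + 1) * (1 + 2 * I) + 738288 / 2 ^ I)))) := by
  have hβ0 : 0 < β := pos_of_klBetaMin_le hβ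
  have hρ0 : ∀ i : ℕ, ∀ a, 0 ≤ klRungProfile L M β μ K n (softSymbolCompl L M β μ K (n + 1) i) Qm a := fun i a => klRungProfile_nonneg β μ K hβ0 n _ Qm a
  -- split off the crossed profile, then the direct one
  refine (klbd_dressing_add (fun x y => C₀ + cd * min (klTorusNorm L (x - y) / klScale klE0 (n + 1)) (klScale klE0 (n + 1) / klTorusNorm L (x - y)))
    (fun x y => cx * min (klTorusNorm L (x + y - Qm') / klScale klE0 (n + 1)) (klScale klE0 (n + 1) / klTorusNorm L (x + y - Qm'))) _ _ m k k').le.trans ?_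
  refine add_le_add ((klbd_dressing_add (fun _ _ => C₀) (fun x y => cd * min (klTorusNorm L (x - y) / klScale klE0 (n + 1)) (klScale klE0 (n + 1) / klTorusNorm L (x - y)))
    _ _ m k k').le.trans (add_le_add ?_ ?_)) ?_
  · exact klbd_const_dressing _ _ h0 hm (hρ0 j) (hρ0 j') (sum_klRungProfile_compl_le β μ K hK hβ hβL (hj'.trans hjj) Qm)
      (sum_klRungProfile_compl_le β μ K hK hβ hβL hj' Qm)
  · exact klbd_minProfile_dressing_rungProfile β μ K hK hβ hβL hj' hjj hη₀ I Qm hd hm k k'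
  · exact klbd_minProfile_dressing_rungProfile_crossed β μ K hK hβ hβL hj' hjj hη₀ I Qm Qm' hx hm k k'

end ThreeTerm

end Summit.HubbardSuperconductivity.HubbardSuperconductivity.Theorems.KLRegimeSplit

end
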